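import Summits.RiemannHypothesis.RiemannHypothesis.Theorems.SemilocalNegCertEmpty
import HarnessLib

/-!
# Semi-local thresholds, negative side, at ANY finite set of primes (I): the window decomposition with
  finitely many atoms, the mollifier criterion, the bridge

Cell `rh-explicit` (HOME `run/shared/lean/pub/rh-explicit/`), seat cc-s2-4 gen7 (A4 SEMILOCAL-TABLE, the Lean side;
design note `HOME/cc-s2-2/a4/NEGCERT-S-DESIGN.md`, cc-s2-2 gen4).  Honest framing: theorems about the tree's
`weilSemilocalThreshold S` (WHERE the `S`-truncated positivity of the Connes–Consani programme stops); nothing here bears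
on RH.

The `{∞,2}` Markov decomposition of lad-2 (`re_weilSemilocalQuadratic_two_eq`, one jump atom `log 2`, windows
`a ≤ log 2`) and its `∅` twin (`re_weilSemilocalQuadratic_empty_eq`, cc-s2-5) are the case `N = 3` of the GENERAL
window decomposition proved here: for a Weil test function `g` with `tsupport g ⊆ [−a, a]`, `a ≤ (log (N+1))/2`,

  `Re Q_S(g) = P(g) + Σ_{n ≤ N} (Λ_S(n)/√n)·D_{log n}(g) + ∫₀^∞ w(t) D_t(g) dt − C_{S,N}‖g‖₂²`,
  `C_{S,N} = C_∅ + 2 Σ_{n ≤ N} Λ_S(n)/√n`   (`C_∅ = log 4π + γ + π/2 + log 2` = `semilocalEmptyConstant`)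

(`re_weilSemilocalQuadratic_eq_window`: the prime term of `k = g ⋆ g̃` is the finite sum over the prime powers
`n ≤ N` by `weilSemilocalPrimeTerm_eq_sum_of_tsupport_subset`, and `k(log n) + k(−log n) = 2‖g‖₂² − D_{log n}(g)`;
the archimedean part is Bombieri's, exactly as in the `{2}` file).  Every energy term is non-negative, so negativity
needs only UPPER bounds of `D`: the mollifier criterion with polar credit
(`IsMarkovWitness.not_weilSemilocalPositivityOn_window_polar`: a bounded odd a.e.-continuous `G` on `[−b, b]` with
`Σ (Λ_S(n)/√n) D_{log n}(G) + ∫₀^∞ w D(G) < C_{S,N}‖G‖₂² + 2|Ĝ(1)|²` kills `S`-positivity on every `C(B)`,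
`b < B ≤ (log (N+1))/2`) and the bridge `weilSemilocalThreshold_le_of_markovWitness_window : … → b < (log (N+1))/2 →
a*(S) ≤ b` follow the `{2}`/`∅` proofs verbatim.  The rational certificate consuming this is `WeilNegCertS`
(`SemilocalNegCertAtoms.lean`).  Folklore throughout.
-/

set_option autoImplicit false
set_option linter.dupNamespace false  -- the mandated namespace repeats `RiemannHypothesis`

noncomputable section

open Complex Filter Set MeasureTheory Topology
open scoped Real

namespace Summit.RiemannHypothesis.RiemannHypothesis.Theorems.MotivicDoor.SemilocalMarkov

open Literature.NumberTheory.LFunctions Literature.NumberTheory.LFunctions.WeilContinuous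
open Summit.RiemannHypothesis.RiemannHypothesis.Theorems.MotivicDoor.SemilocalThreshold

/-! ## The window decomposition with finitely many atoms -/

/-- `Σ_{n ≤ N} Λ_S(n)/√n`: the total weight of the atoms visible on the window `(log (N+1))/2`. -/
def semilocalCoeffSum (S : Finset ℕ) (N : ℕ) : ℝ :=
  ∑ n ∈ Finset.range (N + 1), weilSemilocalCoeff S n

/-- The atom energy `Σ_{n ≤ N} (Λ_S(n)/√n)·D_{log n}(g)`. -/
def semilocalAtomEnergy (S : Finset ℕ) (N : ℕ) (g : ℝ → ℂ) : ℝ :=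
  ∑ n ∈ Finset.range (N + 1), weilSemilocalCoeff S n * weilIncrement g (Real.log n)

/-- The killing constant on the window: `C_{S,N} = C_∅ + 2 Σ_{n ≤ N} Λ_S(n)/√n`. -/
def semilocalWindowConstant (S : Finset ℕ) (N : ℕ) : ℝ :=
  semilocalEmptyConstant + 2 * semilocalCoeffSum S N

/-- The atom energy is non-negative. -/
theorem semilocalAtomEnergy_nonneg (S : Finset ℕ) (N : ℕ) (g : ℝ → ℂ) : 0 ≤ semilocalAtomEnergy S N g :=
  Finset.sum_nonneg fun n _ ↦ mul_nonneg (weilSemilocalCoeff_nonneg S n) (weilIncrement_nonneg g _)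

variable {g : ℝ → ℂ} {a : ℝ}

/-- On a cone `C(a)`, `a ≤ (log (N+1))/2`, the `S`-prime term of `k = g ⋆ g̃` is the finite sum of jumps
`Σ_{n ≤ N} (Λ_S(n)/√n)(k(log n) + k(−log n)) = 2(Σ Λ_S(n)/√n)‖g‖₂² − Σ (Λ_S(n)/√n) D_{log n}(g)`. -/
theorem weilSemilocalPrimeTerm_eq_window (S : Finset ℕ) (N : ℕ) (hg : IsWeilTest g)
    (hsupp : tsupport g ⊆ Icc (-a) a) (ha : a ≤ Real.log ((N : ℝ) + 1) / 2) :
    weilSemilocalPrimeTerm S (weilConv g (weilReflect g)) =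
      ((2 * semilocalCoeffSum S N * (∫ x : ℝ, ‖g x‖ ^ 2) - semilocalAtomEnergy S N g : ℝ) : ℂ) := by
  have hk : IsWeilTest (weilConv g (weilReflect g)) := hg.weilConv hg.weilReflect
  have hsuppk : tsupport (weilConv g (weilReflect g)) ⊆
      Icc (-Real.log ((N : ℝ) + 1)) (Real.log ((N : ℝ) + 1)) := by
    refine (tsupport_weilConv_weilReflect_subset hg.2 hsupp).trans ?_
    exact Icc_subset_Icc (by linarith) (by linarith)
  rw [weilSemilocalPrimeTerm_eq_sum_of_tsupport_subset S hk.1.continuous N hsuppk]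
  have hterm : ∀ n ∈ Finset.range (N + 1),
      (weilSemilocalCoeff S n : ℂ) *
          (weilConv g (weilReflect g) (Real.log n) + weilConv g (weilReflect g) (-Real.log n)) =
        ((weilSemilocalCoeff S n * (2 * (∫ x : ℝ, ‖g x‖ ^ 2) - weilIncrement g (Real.log n)) : ℝ) : ℂ) :=
    fun n _ ↦ by
      rw [weilConv_weilReflect_add_neg hg]
      push_cast
      ring
  rw [Finset.sum_congr rfl hterm, ← Complex.ofReal_sum]
  congr 1
  unfold semilocalCoeffSum semilocalAtomEnergy
  rw [Finset.mul_sum, Finset.sum_mul, ← Finset.sum_sub_distrib]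
  exact Finset.sum_congr rfl fun n _ ↦ by ring

/-- **The window decomposition.**  For a test function `g` with `tsupport g ⊆ [-a,a]`, `a ≤ (log (N+1))/2`:
`Re Q_S(g) = P(g) + Σ_{n ≤ N} (Λ_S(n)/√n) D_{log n}(g) + ∫₀^∞ w D(g) − C_{S,N} ‖g‖₂²`. -/
theorem re_weilSemilocalQuadratic_eq_window (S : Finset ℕ) (N : ℕ) (hg : IsWeilTest g)
    (hsupp : tsupport g ⊆ Icc (-a) a) (ha : a ≤ Real.log ((N : ℝ) + 1) / 2) :
    (weilSemilocalQuadratic S g).re =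
      weilPoleForm g + semilocalAtomEnergy S N g +
        (∫ t in Ioi (0 : ℝ), weilArchDensity t * weilIncrement g t) -
        semilocalWindowConstant S N * ∫ x : ℝ, ‖g x‖ ^ 2 := by
  have hk : IsWeilTest (weilConv g (weilReflect g)) := hg.weilConv hg.weilReflect
  have harch : weilArchTerm (weilConv g (weilReflect g)) = weilArchTermBombieri (weilConv g (weilReflect g)) :=
    (weilArchTermBombieri_eq_weilArchTerm_holds hk).symm
  unfold weilSemilocalQuadratic weilSemilocalFunctional
  rw [Complex.add_re, Complex.sub_re, weilPolarTerm_weilConv_weilReflect_re hg,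
    weilSemilocalPrimeTerm_eq_window S N hg hsupp ha, Complex.ofReal_re, harch,
    weilArchTermBombieri_weilConv_weilReflect hg, Complex.ofReal_re, integral_bombieriIntegrand_eq_sub hg]
  unfold semilocalWindowConstant semilocalEmptyConstant semilocalTwoConstant
  ring

/-! ## The negativity criterion with polar credit on a window -/

namespace IsMarkovWitness

variable {G : ℝ → ℂ} {b M : ℝ} (hW : IsMarkovWitness G b M)
include hW

/-- Mollification does not increase the atom energy (each `D_t` is non-increasing under `⋆ φ_k`). -/
theorem semilocalAtomEnergy_weilConv_moll_le (S : Finset ℕ) (N : ℕ) (k : ℕ) :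
    semilocalAtomEnergy S N (weilConv G (moll k)) ≤ semilocalAtomEnergy S N G :=
  Finset.sum_le_sum fun n _ ↦
    mul_le_mul_of_nonneg_left (hW.weilIncrement_weilConv_moll_le k _) (weilSemilocalCoeff_nonneg S n)

/-- **Negativity of the `S`-form on a window from a Markov witness, polar term included.**  If a bounded
measurable odd a.e.-continuous `G` vanishing off `[-b, b]` has finite archimedean energy and
`Σ_{n ≤ N} (Λ_S(n)/√n) D_{log n}(G) + ∫₀^∞ w D(G) < C_{S,N} ‖G‖₂² + 2|Ĝ(1)|²`, then `S`-Weil positivity fails on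
every cone `C(B)` with `b < B ≤ (log (N+1))/2` (witnesses: the mollifications `G ⋆ φ_k`). -/
theorem not_weilSemilocalPositivityOn_window_polar (S : Finset ℕ) (N : ℕ)
    (hfin : IntegrableOn (fun t ↦ weilArchDensity t * weilIncrement G t) (Ioi 0))
    (hlt : semilocalAtomEnergy S N G + (∫ t in Ioi (0 : ℝ), weilArchDensity t * weilIncrement G t) <
      semilocalWindowConstant S N * (∫ x, ‖G x‖ ^ 2) + 2 * ‖weilMellin G 1‖ ^ 2)
    {B : ℝ} (hbB : b < B) (hB : B ≤ Real.log ((N : ℝ) + 1) / 2) : ¬ WeilSemilocalPositivityOn S B := by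
  intro hpos
  set U := semilocalAtomEnergy S N G + ∫ t in Ioi (0 : ℝ), weilArchDensity t * weilIncrement G t with hU
  have hk : ∀ᶠ k : ℕ in atTop, b + (bump k).rOut < B := by
    have h : Tendsto (fun k ↦ b + (bump k).rOut) atTop (𝓝 (b + 0)) :=
      tendsto_const_nhds.add tendsto_bump_rOut
    rw [add_zero] at h
    exact (tendsto_order.1 h).2 B hbB
  have hle : ∀ᶠ k : ℕ in atTop, semilocalWindowConstant S N * (∫ x, ‖weilConv G (moll k) x‖ ^ 2)
      + 2 * (‖weilMellin G 1‖ ^ 2 * ‖weilMellin (moll k) 1‖ ^ 2) ≤ U := by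
    filter_upwards [hk] with k hk
    have hg := hW.isWeilTest_weilConv_moll k
    have hsupp : tsupport (weilConv G (moll k)) ⊆ Icc (-B) B :=
      (hW.tsupport_weilConv_moll_subset k).trans (Icc_subset_Icc (by linarith) hk.le)
    have h0 := hpos _ hg hsupp
    rw [re_weilSemilocalQuadratic_eq_window S N hg hsupp hB, hW.weilPoleForm_weilConv_moll k] at h0
    have hD1 := hW.semilocalAtomEnergy_weilConv_moll_le S N k
    have hD2 : ∫ t in Ioi (0 : ℝ), weilArchDensity t * weilIncrement (weilConv G (moll k)) t ≤
        ∫ t in Ioi (0 : ℝ), weilArchDensity t * weilIncrement G t :=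
      setIntegral_mono_on (integrableOn_weilArchDensity_mul_weilIncrement hg) hfin measurableSet_Ioi
        (fun t ht ↦ mul_le_mul_of_nonneg_left (hW.weilIncrement_weilConv_moll_le k t)
          (weilArchDensity_pos ht).le)
    linarith
  have hlim : Tendsto (fun k : ℕ ↦ semilocalWindowConstant S N * (∫ x, ‖weilConv G (moll k) x‖ ^ 2)
      + 2 * (‖weilMellin G 1‖ ^ 2 * ‖weilMellin (moll k) 1‖ ^ 2)) atTop
      (𝓝 (semilocalWindowConstant S N * (∫ x, ‖G x‖ ^ 2) + 2 * (‖weilMellin G 1‖ ^ 2 * ‖(1 : ℂ)‖ ^ 2))) :=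
    (hW.tendsto_integral_norm_sq_weilConv_moll.const_mul _).add
      ((((tendsto_weilMellin_moll 1).norm.pow 2).const_mul _).const_mul _)
  rw [norm_one, one_pow, mul_one] at hlim
  have := le_of_tendsto hlim hle
  linarith

end IsMarkovWitness

/-- **Bridge (B−) on a window.**  A Markov witness on `[−b, b]`, `b < (log (N+1))/2`, satisfying the window criterion
gives `a*(S) ≤ b`. -/
theorem weilSemilocalThreshold_le_of_markovWitness_window (S : Finset ℕ) (N : ℕ) {G : ℝ → ℂ} {b M : ℝ}
    (hW : IsMarkovWitness G b M)
    (hfin : IntegrableOn (fun t ↦ weilArchDensity t * weilIncrement G t) (Ioi 0))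
    (hlt : semilocalAtomEnergy S N G + (∫ t in Ioi (0 : ℝ), weilArchDensity t * weilIncrement G t) <
      semilocalWindowConstant S N * (∫ x, ‖G x‖ ^ 2) + 2 * ‖weilMellin G 1‖ ^ 2)
    (hb : b < Real.log ((N : ℝ) + 1) / 2) : weilSemilocalThreshold S ≤ b := by
  by_contra h
  have hlt' : b < min (weilSemilocalThreshold S) (Real.log ((N : ℝ) + 1) / 2) := lt_min (lt_of_not_ge h) hb
  exact hW.not_weilSemilocalPositivityOn_window_polar S N hfin hlt hlt' (min_le_right _ _)
    ((weilSemilocalPositivityOn_weilSemilocalThreshold S).mono (min_le_left _ _))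

end Summit.RiemannHypothesis.RiemannHypothesis.Theorems.MotivicDoor.SemilocalMarkov

end
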